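import Mathlib

/-!
# The zeroth iterate's curve is stadium-analytic: a straight line satisfies `StadiumAnalyticCurve` on every stadium
# (`FilamentSkeletonRss`, child cruxes `TangentSkeletonNearStraight` 28295 / `TangentSkeletonNearStraightL` 23320, lines
# `child_tangent_analytic_strip(_L)`, ∃-side bookkeeping for the `StadiumAnalyticCurve` conjunct AT THE DATUM)

The two-phase scheme of the line starts from the straight datum: `X⁰_j(τ) = √Γ·p_j + τ·t_j`.  Its complexification
`F(z) = cplx(√Γ p_j) + z·cplx(t_j)` is entire with constant derivative `cplx(t_j)`, whose sup norm is `max_i |⟪t_j, e_i⟫| ≤ ‖t_j‖ = 1 ≤ 2`.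
Hence the conjunct `StadiumAnalyticCurve hs L cc X⁰_j` of the line's output `TangentSkeletonAnalytic` holds for EVERY stadium — the
companion, for the curve, of `Theorems.AreaLawSlavingHolo.straightDatum_stadium_analytic_area` (the analytic AREA conjunct at the datum).
Letters: `cplx y = fun i => ((⟪y, EuclideanSpace.single i 1⟫ : ℝ) : ℂ)` and `Stadium` unfolded, as in the line file.

* `abs_inner_single_le` — `|⟪y, e_i⟫| ≤ ‖y‖`;
* `straightLine_stadiumAnalyticCurve` — the statement.

HONEST FRAMING: bookkeeping for a HYPOTHETICAL filament skeleton on the NEGATIVE side of a MODEL route; no registered stub is closed by this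
file and nothing here bears on Navier–Stokes regularity or blow-up.  `--supports stmt-NavierStokesRegularity-28295`.
-/

set_option linter.dupNamespace false

noncomputable section

namespace Summit.NavierStokesRegularity.NavierStokesRegularity.Theorems.StadiumStraightCurve

open Set Metric Real
open scoped InnerProductSpace

/-- `|⟪y, e_i⟫| ≤ ‖y‖` for the standard basis vector `e_i = EuclideanSpace.single i 1`. [folklore] -/
theorem abs_inner_single_le (y : EuclideanSpace ℝ (Fin 3)) (i : Fin 3) :
    |⟪y, EuclideanSpace.single i (1:ℝ)⟫_ℝ| ≤ ‖y‖ := by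
  have h := abs_real_inner_le_norm y (EuclideanSpace.single i (1:ℝ))
  have hn : ‖EuclideanSpace.single i (1:ℝ)‖ = 1 := by
    rw [EuclideanSpace.norm_eq]
    simp
  rw [hn, mul_one] at h
  exact h

/-- **A straight line is stadium-analytic on every stadium** (`StadiumAnalyticCurve` of the line, unfolded; witness
`F(z) = cplx P + z·cplx T`, `‖F′‖ = max_i |⟪T, e_i⟫| ≤ ‖T‖ = 1`). [folklore] -/
theorem straightLine_stadiumAnalyticCurve (hs L cc : ℝ) (P T : EuclideanSpace ℝ (Fin 3)) (hT : ‖T‖ = 1)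
    (X : ℝ → EuclideanSpace ℝ (Fin 3)) (hX : ∀ τ : ℝ, X τ = P + τ • T) :
    ∃ F : ℂ → (Fin 3 → ℂ),
      DifferentiableOn ℂ F {z : ℂ | |z.im| < hs ∧ |z.re - cc| < L + hs} ∧
      (∀ t : ℝ, (t : ℂ) ∈ {z : ℂ | |z.im| < hs ∧ |z.re - cc| < L + hs} →
        F t = fun i => ((⟪X t, EuclideanSpace.single i (1:ℝ)⟫_ℝ : ℝ) : ℂ)) ∧
      ∀ z ∈ {z : ℂ | |z.im| < hs ∧ |z.re - cc| < L + hs}, ‖deriv F z‖ ≤ 2 := by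
  set F : ℂ → (Fin 3 → ℂ) := fun z i =>
    ((⟪P, EuclideanSpace.single i (1:ℝ)⟫_ℝ : ℝ) : ℂ) + z * ((⟪T, EuclideanSpace.single i (1:ℝ)⟫_ℝ : ℝ) : ℂ) with hF
  have hFd : ∀ z : ℂ, HasDerivAt F (fun i => ((⟪T, EuclideanSpace.single i (1:ℝ)⟫_ℝ : ℝ) : ℂ)) z := by
    intro z
    rw [hasDerivAt_pi]
    intro i
    have h := ((hasDerivAt_id z).mul_const (((⟪T, EuclideanSpace.single i (1:ℝ)⟫_ℝ : ℝ) : ℂ))).const_add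
      (((⟪P, EuclideanSpace.single i (1:ℝ)⟫_ℝ : ℝ) : ℂ))
    simpa [hF] using h
  refine ⟨F, fun z _ => (hFd z).differentiableAt.differentiableWithinAt, ?_, ?_⟩
  · intro t _
    funext i
    simp only [hF, hX t, inner_add_left, real_inner_smul_left]
    push_cast
    ring
  · intro z _
    rw [(hFd z).deriv]
    refine (pi_norm_le_iff_of_nonneg (by norm_num)).2 fun i => ?_
    rw [Complex.norm_real, Real.norm_eq_abs]
    exact (abs_inner_single_le T i).trans (by rw [hT]; norm_num)

end Summit.NavierStokesRegularity.NavierStokesRegularity.Theorems.StadiumStraightCurve
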